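import Mathlib.NumberTheory.EulerProduct.DirichletLSeries
import Mathlib.NumberTheory.LSeries.HurwitzZetaValues
import Mathlib.Analysis.PSeries
import Mathlib.Analysis.SpecialFunctions.Log.Basic
import HarnessLib

/-!
# The Euler product of `ζ(2)` truncated at `z`: `1 ≤ (π²/6) ∏_{p < z} (1 − p⁻²) ≤ e^{4/z}`

Topic `Literature/NumberTheory/LFunctions`. Everything in this file is PROVED. From Mathlib's Euler
product `∏_{p < N} (1 − p^{−s})⁻¹ → ζ(s)` (`riemannZeta_eulerProduct`, `Re s > 1`) at `s = 2` and
`ζ(2) = π²/6` (`riemannZeta_two`) we derive the real-variable tail estimate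

* `EulerProductTwo.tendsto_partialProduct` — `∏_{p < N} (1 − p⁻²)⁻¹ → π²/6` in `ℝ`;
* `EulerProductTwo.tail_bounds`, `EulerProductTwo.tail_bounds_real` — for `M ≥ 1` (resp. real
  `z ≥ 1`), the tail `T = (π²/6) ∏_{p < M} (1 − p⁻²) = ∏_{p ≥ M} (1 − p⁻²)⁻¹` satisfies
  `1 ≤ T ≤ exp(4/M)` (resp. `≤ exp(4/z)` for the primes `< z`);
* `EulerProductTwo.mul_prod_one_add_inv_eq` — the identity
  `(π²/6) ∏_{p ∈ S} (1 + 1/p) = ((π²/6) ∏_{p ∈ S} (1 − p⁻²)) · ∏_{p ∈ S} (1 − 1/p)⁻¹`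
  (`1 − p⁻² = (1 − 1/p)(1 + 1/p)`), i.e. `ζ(2) ∏_{p<z}(1 + 1/p) = (1 + O(1/z)) ∏_{p<z} (1 − 1/p)⁻¹`.

This is the "product simplification" `F'(1) ∏_{p<z}(1 + 1/p) ∏_p ((1+1/p)(1−1/p))⁻¹ =
(1 + O(1/z)) ∏_{p<z}(1 − 1/p)⁻¹` of Matomäki–Merikoski, arXiv:2112.11412, §6 (proof of Lemma 2.4),
`F'(1) = ∏_p (1 − p⁻²)⁻¹ = ζ(2)`.

## References

* K. Matomäki, J. Merikoski, IMRN 2023 (arXiv:2112.11412), §6. [cite: MatomakiMerikoski2023, §6]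
-/

noncomputable section

open Finset Real Filter Topology

namespace Literature.NumberTheory.LFunctions

namespace EulerProductTwo

/-! ### The partial Euler products of `ζ(2)` over `ℝ` -/

/-- The complex partial products at `s = 2` are the real ones. [folklore] -/
theorem prod_complex_eq (n : ℕ) :
    ∏ p ∈ Nat.primesBelow n, (1 - (p : ℂ) ^ (-(2 : ℂ)))⁻¹ =
      ((∏ p ∈ Nat.primesBelow n, (1 - ((p : ℝ) ^ 2)⁻¹)⁻¹ : ℝ) : ℂ) := by
  push_cast
  refine Finset.prod_congr rfl fun p hp => ?_
  have hp0 : (p : ℂ) ≠ 0 := by exact_mod_cast (Nat.prime_of_mem_primesBelow hp).ne_zero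
  rw [Complex.cpow_neg, show (2 : ℂ) = ((2 : ℕ) : ℂ) by norm_num, Complex.cpow_natCast]

/-- **`∏_{p < N} (1 − p⁻²)⁻¹ → π²/6`** (Euler product of `ζ(2)`, real form). [folklore] -/
theorem tendsto_partialProduct :
    Tendsto (fun n : ℕ => ∏ p ∈ Nat.primesBelow n, (1 - ((p : ℝ) ^ 2)⁻¹)⁻¹) atTop (𝓝 (π ^ 2 / 6)) := by
  have h := riemannZeta_eulerProduct (s := 2) (by norm_num)
  rw [riemannZeta_two] at h
  have h2 : Tendsto (fun n : ℕ => ((∏ p ∈ Nat.primesBelow n, (1 - ((p : ℝ) ^ 2)⁻¹)⁻¹ : ℝ) : ℂ))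
      atTop (𝓝 (((π ^ 2 / 6 : ℝ) : ℂ))) := by
    have : ((π ^ 2 / 6 : ℝ) : ℂ) = (π : ℂ) ^ 2 / 6 := by push_cast; ring
    rw [this]
    exact h.congr fun n => prod_complex_eq n
  have h3 := (Complex.continuous_re.tendsto _).comp h2
  simp only [Function.comp_def, Complex.ofReal_re] at h3
  exact h3

/-- Each Euler factor `(1 − p⁻²)⁻¹ ≥ 1`, and `≤ exp(2/p²)`. [folklore] -/
theorem one_le_factor {p : ℕ} (hp : p.Prime) :
    1 ≤ (1 - ((p : ℝ) ^ 2)⁻¹)⁻¹ ∧ (1 - ((p : ℝ) ^ 2)⁻¹)⁻¹ ≤ Real.exp (2 * ((p : ℝ) ^ 2)⁻¹) := by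
  have hp2 : (2 : ℝ) ≤ p := by exact_mod_cast hp.two_le
  have hx0 : 0 < ((p : ℝ) ^ 2)⁻¹ := by positivity
  have hx : ((p : ℝ) ^ 2)⁻¹ ≤ 1 / 4 := by
    rw [inv_eq_one_div, div_le_div_iff₀ (by positivity) (by norm_num)]
    nlinarith
  have h1 : 0 < 1 - ((p : ℝ) ^ 2)⁻¹ := by linarith
  constructor
  · rw [one_le_inv_iff₀]; exact ⟨h1, by linarith⟩
  · -- `(1 − x)⁻¹ ≤ exp(2x)` for `0 ≤ x ≤ 1/4`: `log (1−x)⁻¹ ≤ (1−x)⁻¹ − 1 = x/(1−x) ≤ 2x`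
    rw [← Real.exp_log (inv_pos.mpr h1), Real.exp_le_exp]
    have h2 : Real.log (1 - ((p : ℝ) ^ 2)⁻¹)⁻¹ ≤ (1 - ((p : ℝ) ^ 2)⁻¹)⁻¹ - 1 :=
      Real.log_le_sub_one_of_pos (inv_pos.mpr h1)
    have h3 : (1 - ((p : ℝ) ^ 2)⁻¹)⁻¹ - 1 ≤ 2 * ((p : ℝ) ^ 2)⁻¹ := by
      rw [sub_le_iff_le_add, inv_le_comm₀ h1 (by positivity)]
      -- `1/(1 + 2x) ≤ 1 − x` iff `1 ≤ (1−x)(1+2x) = 1 + x − 2x²`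
      rw [inv_eq_one_div, div_le_iff₀ (by positivity)]
      nlinarith
    linarith

/-- The product of the Euler factors over a finite set of primes lies in `[1, exp(2 ∑ p⁻²)]`.
[folklore] -/
theorem prod_factor_bounds {S : Finset ℕ} (hS : ∀ p ∈ S, p.Prime) :
    1 ≤ ∏ p ∈ S, (1 - ((p : ℝ) ^ 2)⁻¹)⁻¹ ∧
      ∏ p ∈ S, (1 - ((p : ℝ) ^ 2)⁻¹)⁻¹ ≤ Real.exp (∑ p ∈ S, 2 * ((p : ℝ) ^ 2)⁻¹) := by
  constructor
  · calc (1 : ℝ) = ∏ _p ∈ S, (1 : ℝ) := Finset.prod_const_one.symm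
      _ ≤ _ := Finset.prod_le_prod (fun _ _ => zero_le_one) fun p hp => (one_le_factor (hS p hp)).1
  · rw [Real.exp_sum]
    exact Finset.prod_le_prod (fun p hp => zero_le_one.trans (one_le_factor (hS p hp)).1)
      fun p hp => (one_le_factor (hS p hp)).2

/-- `∑_{M ≤ p < N, p prime} 2/p² ≤ 4/M` for `M ≥ 1`. [folklore] -/
theorem sum_window_le {M : ℕ} (hM : 1 ≤ M) (N : ℕ) :
    ∑ p ∈ Nat.primesBelow N \ Nat.primesBelow M, 2 * ((p : ℝ) ^ 2)⁻¹ ≤ 4 / M := by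
  have hsub : Nat.primesBelow N \ Nat.primesBelow M ⊆ Ioo (M - 1) N := by
    intro p hp
    rw [Finset.mem_sdiff, Nat.mem_primesBelow, Nat.mem_primesBelow, not_and'] at hp
    rw [mem_Ioo]
    have := hp.2 hp.1.2
    omega
  calc ∑ p ∈ Nat.primesBelow N \ Nat.primesBelow M, 2 * ((p : ℝ) ^ 2)⁻¹
      ≤ ∑ p ∈ Ioo (M - 1) N, 2 * ((p : ℝ) ^ 2)⁻¹ :=
        Finset.sum_le_sum_of_subset_of_nonneg hsub fun p _ _ => by positivity
    _ = 2 * ∑ p ∈ Ioo (M - 1) N, ((p : ℝ) ^ 2)⁻¹ := by rw [Finset.mul_sum]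
    _ ≤ 2 * (2 / ((M - 1 : ℕ) + 1)) := mul_le_mul_of_nonneg_left (sum_Ioo_inv_sq_le _ _) (by norm_num)
    _ = 4 / M := by
        rw [Nat.cast_sub hM, Nat.cast_one, sub_add_cancel]
        ring

/-! ### The tail `T(z) = (π²/6) ∏_{p < z} (1 − p⁻²)` -/

/-- **The tail of the Euler product of `ζ(2)`**: for `M ≥ 1`,
`1 ≤ (π²/6) ∏_{p < M} (1 − p⁻²) ≤ exp(4/M)` (it is the limit of `∏_{M ≤ p < N} (1 − p⁻²)⁻¹`).
[folklore] -/
theorem tail_bounds {M : ℕ} (hM : 1 ≤ M) :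
    1 ≤ π ^ 2 / 6 * ∏ p ∈ Nat.primesBelow M, (1 - ((p : ℝ) ^ 2)⁻¹) ∧
      π ^ 2 / 6 * ∏ p ∈ Nat.primesBelow M, (1 - ((p : ℝ) ^ 2)⁻¹) ≤ Real.exp (4 / M) := by
  set E : ℕ → ℝ := fun n => ∏ p ∈ Nat.primesBelow n, (1 - ((p : ℝ) ^ 2)⁻¹)⁻¹ with hE
  have hprime : ∀ n, ∀ p ∈ Nat.primesBelow n, p.Prime := fun n p hp => Nat.prime_of_mem_primesBelow hp
  have hEpos : ∀ n, 0 < E n := fun n => lt_of_lt_of_le zero_lt_one (prod_factor_bounds (hprime n)).1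
  -- `E M · ∏_{p<M} (1 − p⁻²) = 1`
  have hinv : E M * ∏ p ∈ Nat.primesBelow M, (1 - ((p : ℝ) ^ 2)⁻¹) = 1 := by
    rw [hE, ← Finset.prod_mul_distrib]
    refine Finset.prod_eq_one fun p hp => inv_mul_cancel₀ ?_
    have := (one_le_factor (hprime M p hp)).1
    intro h; rw [h, inv_zero] at this; linarith
  -- the quotient `E N / E M = ∏_{M ≤ p < N}` for `N ≥ M`, with its bounds
  have hratio : ∀ N, M ≤ N → 1 ≤ E N / E M ∧ E N / E M ≤ Real.exp (4 / M) := by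
    intro N hMN
    have hsub : Nat.primesBelow M ⊆ Nat.primesBelow N := fun p hp => by
      rw [Nat.mem_primesBelow] at hp ⊢; exact ⟨lt_of_lt_of_le hp.1 hMN, hp.2⟩
    have hsplit : E N = (∏ p ∈ Nat.primesBelow N \ Nat.primesBelow M, (1 - ((p : ℝ) ^ 2)⁻¹)⁻¹) * E M := by
      rw [hE, Finset.prod_sdiff hsub]
    have hq : E N / E M = ∏ p ∈ Nat.primesBelow N \ Nat.primesBelow M, (1 - ((p : ℝ) ^ 2)⁻¹)⁻¹ := by
      rw [hsplit, mul_div_assoc, div_self (hEpos M).ne', mul_one]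
    rw [hq]
    have hb := prod_factor_bounds (S := Nat.primesBelow N \ Nat.primesBelow M)
      fun p hp => hprime N p (Finset.mem_sdiff.mp hp).1
    exact ⟨hb.1, hb.2.trans (Real.exp_le_exp.mpr (sum_window_le hM N))⟩
  -- pass to the limit `N → ∞`
  have hlim : Tendsto (fun N => E N / E M) atTop (𝓝 (π ^ 2 / 6 / E M)) :=
    tendsto_partialProduct.div_const _
  have hval : π ^ 2 / 6 / E M = π ^ 2 / 6 * ∏ p ∈ Nat.primesBelow M, (1 - ((p : ℝ) ^ 2)⁻¹) := by
    rw [div_eq_mul_inv]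
    congr 1
    rw [eq_comm, ← mul_eq_one_iff_eq_inv₀ (hEpos M).ne', mul_comm]
    exact hinv
  rw [← hval]
  constructor
  · exact ge_of_tendsto hlim (Filter.eventually_atTop.mpr ⟨M, fun N hN => (hratio N hN).1⟩)
  · exact le_of_tendsto hlim (Filter.eventually_atTop.mpr ⟨M, fun N hN => (hratio N hN).2⟩)

/-- Real-variable form: for `z ≥ 1`, `1 ≤ (π²/6) ∏_{p < z} (1 − p⁻²) ≤ exp(4/z)` (the primes `p < z`
are `Nat.primesBelow ⌈z⌉₊`). [cite: MatomakiMerikoski2023, §6] -/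
theorem tail_bounds_real {z : ℝ} (hz : 1 ≤ z) :
    1 ≤ π ^ 2 / 6 * ∏ p ∈ Nat.primesBelow ⌈z⌉₊, (1 - ((p : ℝ) ^ 2)⁻¹) ∧
      π ^ 2 / 6 * ∏ p ∈ Nat.primesBelow ⌈z⌉₊, (1 - ((p : ℝ) ^ 2)⁻¹) ≤ Real.exp (4 / z) := by
  have hz0 : 0 < z := by linarith
  have hM : 1 ≤ ⌈z⌉₊ := Nat.ceil_pos.mpr hz0
  obtain ⟨h1, h2⟩ := tail_bounds hM
  refine ⟨h1, h2.trans (Real.exp_le_exp.mpr ?_)⟩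
  exact div_le_div_of_nonneg_left (by norm_num) hz0 (Nat.le_ceil z)

/-- **The product simplification** `(π²/6) ∏_{p ∈ S} (1 + 1/p) = ((π²/6) ∏_{p ∈ S} (1 − p⁻²)) ∏_{p ∈ S} (1 − 1/p)⁻¹`
over any finite set of primes `S` (`1 − p⁻² = (1 − 1/p)(1 + 1/p)`); with `S` the primes `< z` the
middle factor is `1 + O(1/z)` by `tail_bounds_real`. [cite: MatomakiMerikoski2023, §6] -/
theorem mul_prod_one_add_inv_eq {S : Finset ℕ} (hS : ∀ p ∈ S, p.Prime) :
    π ^ 2 / 6 * ∏ p ∈ S, (1 + (p : ℝ)⁻¹) =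
      (π ^ 2 / 6 * ∏ p ∈ S, (1 - ((p : ℝ) ^ 2)⁻¹)) * ∏ p ∈ S, (1 - (p : ℝ)⁻¹)⁻¹ := by
  rw [mul_assoc, ← Finset.prod_mul_distrib]
  congr 1
  refine Finset.prod_congr rfl fun p hp => ?_
  have hp1 : (1 : ℝ) < p := by exact_mod_cast (hS p hp).one_lt
  have hp0 : (p : ℝ) ≠ 0 := by positivity
  have hp1' : (p : ℝ) - 1 ≠ 0 := by linarith
  have h1 : 1 - (p : ℝ)⁻¹ ≠ 0 := by
    rw [sub_ne_zero, ne_comm, Ne, inv_eq_one]; exact_mod_cast (hS p hp).one_lt.ne'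
  field_simp
  ring

end EulerProductTwo

end Literature.NumberTheory.LFunctions
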